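import Summits.BirchSwinnertonDyer.BirchSwinnertonDyer.Theorems.RamifiedHeegnerPairTwistUnitSaving
import HarnessLib

/-!
# U₀ at the SAVING ROWS of the Gss2 census (rank zero), TU₀|saving — part F: `154836v1`, `212940t1`

Continuation of `…Theorems.RamifiedHeegnerPairTwistUnitSaving` (seat `bsd-trib-w-rhp` g15; doors, framing and data provenance there; generic kernel lemmas g14's `…TwistUnitInert`):
per rank zero curve `subGss_three_/Δ_eq_/c₄_eq_/krausList_/surj_three_<label>` IN THE KERNEL, Kraus minimality of `V = E^{(-3)}_min` and of the twist model `Wd`, and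
`u0s_at_<label> : … → MissingUpperBoundAt W 3` by p674548 `LeafShimuraInert.leafRankZeroUpper_three_of_shimuraInertDatum_at_saving_of_twistUnitZero` through
`leafRankZeroUpper_three_at_saving_of_sqrtField` — printed facts `hGZK hmod hnf hJL hCO hPrim` as hypotheses; `q₁ ∣ Δ_min`, multiplicative / no-split / Tate certificates, `hFC`, `hshape` off `q₁`, (DEG), field
congruences IN THE KERNEL; `hN hr Dt hc` + `L(E^D,1) = 0 ≠ L′(E^D,1)` + `#Ш(Wd)_an` DISPLAYED.  **HONEST FRAMING: theorems only; nothing booked, no item closed; U₀ (26024) / TU|saving / the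
Shimura-curve Heegner-system inputs stay research-level and OPEN class-wide; BSD is NOT proved for any curve by this file.**
[cite: JetchevSkinnerWan2017, §7.4.2 (p. 31)] [cite: PastenShimura2024, Prop. 6.13, Lemma 6.15, Lemma 6.18] [cite: Serre1972, §2.8] [cite: Kraus1989, Prop. 1] [cite: Cremona2006, Table 1]
-/

set_option linter.dupNamespace false
set_option autoImplicit false

noncomputable section

open scoped Classical NumberField

open WeierstrassCurve NumberField IsDedekindDomain IsDedekindDomain.HeightOneSpectrum Rat.HeightOneSpectrum Field Literature Literature.NumberTheory.DiophantineGeometry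
  Literature.NumberTheory.EllipticCurves Literature.NumberTheory.EllipticCurves.ModularForms Literature.NumberTheory.EllipticCurves.Rank1Residual
  Literature.NumberTheory.EllipticCurves.Rank1Residual.Typed Literature.NumberTheory.Automorphic Literature.NumberTheory.EllipticCurves.Rank1Residual.X11RankOneCertificates
  Literature.NumberTheory.EllipticCurves.KrizLi2019 Literature.NumberTheory.GaloisRepresentations Literature.NumberTheory.QuadraticFields Literature.NumberTheory.QuadraticFields.Quadratic
  Summit.BirchSwinnertonDyer.BirchSwinnertonDyer.Rank1Residual Summit.BirchSwinnertonDyer.BirchSwinnertonDyer.Rank1Residual.IntModel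
  Summit.BirchSwinnertonDyer.BirchSwinnertonDyer.Rank2Observatory.Tam Summit.BirchSwinnertonDyer.Rank1Residual Summit.BirchSwinnertonDyer.Rank1Residual.Additive
  Summit.BirchSwinnertonDyer.Rank1Residual.X11b Summit.BirchSwinnertonDyer.Rank1Residual.X11b.Three Summit.BirchSwinnertonDyer.Rank1Residual.X9 Summit.BirchSwinnertonDyer.Rank1Residual.GaloisImage
  Summit.BirchSwinnertonDyer.Rank1Residual.Supersingular Summit.BirchSwinnertonDyer.BirchSwinnertonDyer.Theses.RamifiedHeegnerPair Summit.BirchSwinnertonDyer.BirchSwinnertonDyer.Theorems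
  Summit.BirchSwinnertonDyer.BirchSwinnertonDyer.Theorems.SchneiderFree Summit.BirchSwinnertonDyer.BirchSwinnertonDyer.Theorems.RamifiedPairUpperBound
  Summit.BirchSwinnertonDyer.BirchSwinnertonDyer.Theorems.RamifiedHeegnerPairStepLIntrinsic Summit.BirchSwinnertonDyer.BirchSwinnertonDyer.Theorems.AdditiveBranchIMCGordTwoRankOne.HeegnerKolyvagin
  Summit.BirchSwinnertonDyer.BirchSwinnertonDyer.Theorems.RamifiedHeegnerPairTwistUnitIntrinsic Summit.BirchSwinnertonDyer.BirchSwinnertonDyer.Theorems.RamifiedHeegnerPairTwistUnitAdditive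
  Summit.BirchSwinnertonDyer.BirchSwinnertonDyer.Theorems.RamifiedHeegnerPairTwistUnitInert

namespace Summit.BirchSwinnertonDyer.BirchSwinnertonDyer.Theorems.RamifiedHeegnerPairTwistUnitSaving

open RamifiedHeegnerPairTwistUnitInert

/-! ## §9 `154836v1` = `[0, 0, 0, -4892688, -4165521660]`, `N = 154836 = 2^2·3^2·11·17·23` (`2`: IV*, `c = 3`, `3`: I₀*, `c = 2`, `11`: I3, `c = 3`, split, `17`: I1, `c = 1`, non-split, `23`: I2, `c = 2`, non-split); exempted carrier `q₁ = 2` (additive IV*, `c = 3`), inert set `S = {17, 11}` (multiplicative), (DEG) très ramifié at `s₁ = 17` (`3 ∤ ord_{17} Δ = 1`);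
`ρ̄₃` onto (certificate primes `ℓ₁ = 5`, `#Ẽ(𝔽_{5}) = 2`; `ℓ₂ = 31`, `#Ẽ(𝔽_{31}) = 30`); `r_an = 0`, `#E(ℚ)_tors = 1`, `∏ c_ℓ = 36`, `#Ш(E)_an = 4` (Cremona/LMFDB, displayed where used); class `154836v` of size 1.
`V = E^{(-3)}_min = [0, 0, 0, -543632, 154278580]` (`#Ṽ(𝔽₃) = 4`).  JSW field `K = ℚ(√-551)` (`551 = 19·29`; `17`, `11` inert, every other `ℓ ∣ N` split): the least such `D` (among those tried) with a CERTIFIED twist unit (kit j322551: root no. `−1`, `L′(Wd,1) = 19.260701`, `Wd = E^{(-551)}_min = [0, 0, 0, -1485424969488, 696825754365210660]`, `N(Wd) = 47008364436`, `∏c = 24`, `T = 1`, point by `ellrank(effort=0)`, eclib-full saturation (index 1), `ĥ = 39.675703`,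
`X = L′T²/(Ω∏c ĥ) = 1` to `0e+00` — the numerical `#Ш(Wd)_an` given rank `1`). -/

/-- `V = [0, 0, 0, -543632, 154278580]` (the minimal model of `154836v1^{(-3)}`, conductor `17204`): `Δ ≠ 0` in the kernel. [cite: Cremona2006, Table 1 (Cremona label 154836v1)] -/
theorem isElliptic_sV154836v1 : (⟨0, 0, 0, -543632, 154278580⟩ : WeierstrassCurve ℚ).IsElliptic :=
  isElliptic_of_discOf_ne_zero 0 0 0 (-543632) 154278580 (by decide +kernel)

/-- `V` is globally minimal: `|Δ| = 2^8·11^3·17·23^2` kernel-checked, Kraus' criterion prime by prime. [cite: Kraus1989, Prop. 1 and Prop. 2]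
[cite: SilvermanAEC2009, VII.1 Remark 1.1] [cite: Cremona2006, Table 1 (Cremona label 154836v1)] -/
theorem isGloballyMinimal_sV154836v1 : (⟨0, 0, 0, -543632, 154278580⟩ : WeierstrassCurve ℚ).IsGloballyMinimal :=
  isGloballyMinimal_of_krausCriterion₃_factored 0 0 0 (-543632) 154278580
    [(2, 8), (11, 3), (17, 1), (23, 2)] (by decide +kernel)
    (by intro qe hqe; simp only [List.mem_cons, List.not_mem_nil, or_false] at hqe
        rcases hqe with rfl | rfl | rfl | rfl <;> norm_num)
    (by set_option synthInstance.maxSize 2000 in decide +kernel)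

/-- `Wd = [0, 0, 0, -1485424969488, 696825754365210660]` (the minimal model of the twist `154836v1^{(-551)}`, conductor `47008364436`): `Δ ≠ 0` in the kernel. [cite: Cremona2006, Table 1 (Cremona label 154836v1)] -/
theorem isElliptic_sWd154836v1 : (⟨0, 0, 0, -1485424969488, 696825754365210660⟩ : WeierstrassCurve ℚ).IsElliptic :=
  isElliptic_of_discOf_ne_zero 0 0 0 (-1485424969488) 696825754365210660 (by decide +kernel)

/-- `Wd` is globally minimal: `|Δ| = 2^8·3^6·11^3·17·19^6·23^2·29^6` kernel-checked, Kraus' criterion prime by prime. [cite: Kraus1989, Prop. 1 and Prop. 2]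
[cite: SilvermanAEC2009, VII.1 Remark 1.1] [cite: Cremona2006, Table 1 (Cremona label 154836v1)] -/
theorem isGloballyMinimal_sWd154836v1 : (⟨0, 0, 0, -1485424969488, 696825754365210660⟩ : WeierstrassCurve ℚ).IsGloballyMinimal :=
  isGloballyMinimal_of_krausCriterion₃_factored 0 0 0 (-1485424969488) 696825754365210660
    [(2, 8), (3, 6), (11, 3), (17, 1), (19, 6), (23, 2), (29, 6)] (by decide +kernel)
    (by intro qe hqe; simp only [List.mem_cons, List.not_mem_nil, or_false] at hqe
        rcases hqe with rfl | rfl | rfl | rfl | rfl | rfl | rfl <;> norm_num)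
    (by set_option synthInstance.maxSize 2000 in decide +kernel)

/-- **`154836v1` is ADDITIVE at `3` and on the cell (G) ∧ ss, IN THE KERNEL**: `3 ∣ Δ`, `3 ∣ c₄`; `C • V^{(-3)} = E` (`[u, r, s, t] = [1, 0, 0, 0]`) with
`V` globally minimal, `3 ∤ Δ(V)`, `#Ṽ(𝔽₃) = 4` (`a₃(V) = 0`, supersingular), whence `TypeG`, `SubGord`, `SubGss` at `3` (g13's block, unchanged).
[cite: SilvermanAEC2009, VII.5 Prop. 5.1 (a), (c)] [cite: Delbourgo1998, §1.5 (G)] [cite: Cremona2006, Table 1 (Cremona label 154836v1)] -/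
theorem subGss_three_154836v1 {W : WeierstrassCurve ℚ} [W.IsElliptic] [W.IsGloballyMinimal] (hWeq : W = (⟨0, 0, 0, -4892688, -4165521660⟩ : WeierstrassCurve ℚ)) :
    Addv W 3 ∧ SubGss W 3 := by
  subst hWeq
  haveI := isElliptic_sV154836v1
  haveI := isGloballyMinimal_sV154836v1
  have hIW : integralModelInt (⟨0, 0, 0, -4892688, -4165521660⟩ : WeierstrassCurve ℚ) = (⟨0, 0, 0, -4892688, -4165521660⟩ : WeierstrassCurve ℤ) :=
    integralModelInt_eq_of_map_eq _ (map_mk_int 0 0 0 (-4892688) (-4165521660))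
  have hadd : Addv (⟨0, 0, 0, -4892688, -4165521660⟩ : WeierstrassCurve ℚ) 3 := Additive.addv_of_intModel hIW 3 (by decide +kernel) (by decide +kernel)
  have hIV : integralModelInt (⟨0, 0, 0, -543632, 154278580⟩ : WeierstrassCurve ℚ) = (⟨0, 0, 0, -543632, 154278580⟩ : WeierstrassCurve ℤ) :=
    integralModelInt_eq_of_map_eq _ (map_mk_int 0 0 0 (-543632) 154278580)
  have hcV : Nat.card ((((⟨0, 0, 0, -543632, 154278580⟩ : WeierstrassCurve ℤ)).map (Int.castRingHom (ZMod 3))).toAffine.Point) = 4 := by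
    have h := natCard_point_eq_countPoints 0 0 0 (-543632) 154278580 3 (by norm_num) (by decide +kernel)
    have h' : countPoints [0, 0, 0, -543632, 154278580] 3 = 4 := countPoints_eq_of_fast (by decide +kernel)
    exact_mod_cast h.trans h'
  have hgood : GoodSS (⟨0, 0, 0, -543632, 154278580⟩ : WeierstrassCurve ℚ) 3 := Supersingular.goodSS_of_intModel 3 hIV (by decide +kernel) hcV (by decide)
  have hVW : (⟨1, (0 : ℚ), (0 : ℚ), (0 : ℚ)⟩ : VariableChange ℚ) • (⟨0, 0, 0, -543632, 154278580⟩ : WeierstrassCurve ℚ).quadraticTwist (-3) =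
      (⟨0, 0, 0, -4892688, -4165521660⟩ : WeierstrassCurve ℚ) := by
    ext <;> simp [WeierstrassCurve.variableChange_a₁, WeierstrassCurve.variableChange_a₂,
      WeierstrassCurve.variableChange_a₃, WeierstrassCurve.variableChange_a₄, WeierstrassCurve.variableChange_a₆,
      WeierstrassCurve.quadraticTwist, WeierstrassCurve.b₂, WeierstrassCurve.b₄, WeierstrassCurve.b₆] <;> norm_num
  obtain ⟨C, hC⟩ := exists_variableChange_quadraticTwist_symm (⟨0, 0, 0, -4892688, -4165521660⟩ : WeierstrassCurve ℚ)
    (⟨0, 0, 0, -543632, 154278580⟩ : WeierstrassCurve ℚ) (d := (-3 : ℚ)) (by norm_num) ⟨_, hVW⟩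
  have hC' : C • (⟨0, 0, 0, -4892688, -4165521660⟩ : WeierstrassCurve ℚ).quadraticTwist ((-1 : ℚ) ^ ((3 : ℕ) / 2) * (3 : ℕ)) =
      (⟨0, 0, 0, -543632, 154278580⟩ : WeierstrassCurve ℚ) := by
    rw [O5.pstar_three]; exact hC
  have hG : TypeG (⟨0, 0, 0, -4892688, -4165521660⟩ : WeierstrassCurve ℚ) 3 := (typeG_three_iff_good_twist _ hadd _ C hC').mpr hgood.1
  exact ⟨hadd, (O5.subGss_three_iff_subGord_and_goodSS_twist _ hadd _ C hC).mpr
    ⟨subGord_three_of_typeG_of_addv _ hG hadd, hgood⟩⟩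

/-- `Δ(E₀) = -2233830120192 = -2^8·3^6·11^3·17·23^2` on the integer equation of `154836v1`. [cite: Cremona2006, Table 1 (Cremona label 154836v1)] -/
theorem Δ_eq_154836v1 : (⟨0, 0, 0, -4892688, -4165521660⟩ : WeierstrassCurve ℤ).Δ = -2233830120192 := by
  norm_num [WeierstrassCurve.Δ, WeierstrassCurve.b₂, WeierstrassCurve.b₄, WeierstrassCurve.b₆, WeierstrassCurve.b₈]

/-- `c₄(E₀) = 234849024` on the integer equation of `154836v1`. [cite: Cremona2006, Table 1 (Cremona label 154836v1)] -/
theorem c₄_eq_154836v1 : (⟨0, 0, 0, -4892688, -4165521660⟩ : WeierstrassCurve ℤ).c₄ = 234849024 := by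
  norm_num [WeierstrassCurve.c₄, WeierstrassCurve.b₂, WeierstrassCurve.b₄]

/-- The Kraus list of `154836v1` consists of primes and multiplies to `|Δ(E₀)|`, IN THE KERNEL: a prime dividing `Δ_min` is one of `[2, 3, 11, 17, 23]`. [cite: Cremona2006, Table 1 (Cremona label 154836v1)] -/
theorem krausList_154836v1 : (∀ qe ∈ ([(2, 8), (3, 6), (11, 3), (17, 1), (23, 2)] : List (ℕ × ℕ)), qe.1.Prime) ∧
    (([(2, 8), (3, 6), (11, 3), (17, 1), (23, 2)] : List (ℕ × ℕ)).map fun qe => qe.1 ^ qe.2).prod = (-2233830120192 : ℤ).natAbs :=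
  ⟨by decide +kernel, by decide +kernel⟩

/-- **`ρ̄_{E,3}` ONTO for `154836v1`, IN THE KERNEL** (Frobenius-order witness `hasSurjectiveModNGaloisRep_of_intModel_of_irr_of_order`): at the good prime `ℓ₁ = 5` (`#Ẽ(𝔽_{5}) = 2`,
`a = 4`) `X² − aX + 5` is irreducible mod `3`; at `ℓ₂ = 31 ≡ 1 (mod 3)` (`#Ẽ = 30`, `a = 2 ≡ 2`, `9 ∤ 30`) an element of order `3`; point counts by `countPoints_eq_of_fast`
(Sage's `is_surjective(3)` agrees). [cite: Serre1972, §2.8 Prop. 19] [cite: Zywina2015, §1] [cite: Cremona2006, Table 1 (Cremona label 154836v1)] -/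
theorem surj_three_154836v1 {W : WeierstrassCurve ℚ} [W.IsElliptic] [W.IsGloballyMinimal] (hWeq : W = (⟨0, 0, 0, -4892688, -4165521660⟩ : WeierstrassCurve ℚ)) : Surj W 3 := by
  subst hWeq
  haveI : Fact (Nat.Prime 5) := ⟨by norm_num⟩
  haveI : Fact (Nat.Prime 31) := ⟨by norm_num⟩
  have hI : integralModelInt (⟨0, 0, 0, -4892688, -4165521660⟩ : WeierstrassCurve ℚ) = (⟨0, 0, 0, -4892688, -4165521660⟩ : WeierstrassCurve ℤ) :=
    integralModelInt_eq_of_map_eq _ (map_mk_int 0 0 0 (-4892688) (-4165521660))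
  have hc₁ : Nat.card ((((⟨0, 0, 0, -4892688, -4165521660⟩ : WeierstrassCurve ℤ)).map (Int.castRingHom (ZMod 5))).toAffine.Point) = 2 := by
    exact_mod_cast (natCard_point_eq_countPoints 0 0 0 (-4892688) (-4165521660) 5 (by norm_num) (by decide +kernel)).trans (countPoints_eq_of_fast (n := 2) (by decide +kernel))
  have hc₂ : Nat.card ((((⟨0, 0, 0, -4892688, -4165521660⟩ : WeierstrassCurve ℤ)).map (Int.castRingHom (ZMod 31))).toAffine.Point) = 30 := by
    exact_mod_cast (natCard_point_eq_countPoints 0 0 0 (-4892688) (-4165521660) 31 (by norm_num) (by decide +kernel)).trans (countPoints_eq_of_fast (n := 30) (by decide +kernel))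
  exact hasSurjectiveModNGaloisRep_of_intModel_of_irr_of_order hI 3 5 31 (by norm_num) (by norm_num) (by rw [Δ_eq_154836v1]; norm_num)
    (by rw [Δ_eq_154836v1]; norm_num) hc₁ hc₂ (by decide) (by decide) (by decide) (by decide)

/-- **U₀ AT `154836v1` ON ITS SAVING ROW (inert-set Shimura-curve road, TU₀|saving)** — `MissingUpperBoundAt W 3` at `W = E` (`r_an = 0`) from rhp-p2 g11's shape
p674548 `leafRankZeroUpper_three_of_shimuraInertDatum_at_saving_of_twistUnitZero` through the door `leafRankZeroUpper_three_at_saving_of_sqrtField`.  PRINTED: `hGZK hmod hnf hJL hCO hPrim`.  KERNEL: `Addv ∧ SubGss` at `3`; `ρ̄₃` onto;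
`q₁ = 2 ∣ Δ_min`; `17`, `11` multiplicative; every prime of `Δ_min` enumerated (`krausList_154836v1`) for `hFC` and for `hshape` off `q₁` (`c = 1` off `Δ_min`, Kodaira–Néron at multiplicative
primes, Tate certificates at the additive primes `[3]`); (DEG) très ramifié at `s₁ = 17`; the congruences making `17`, `11` inert and the other `ℓ ∣ N` split in
`ℚ(√-551)`; `Cd • E^{(-551)} = Wd`, `Cd = [1, 0, 0, 0]`, `Wd` Kraus-minimal.  DISPLAYED: `hN`, `hr` (`r_an = 0`), `Dt`/`hc`, `hLt0`/`hLt1` (`L(E^{(-551)},1) = 0 ≠ L′`; census: root no. `−1`,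
`L′(Wd,1) ≈ 19.26070`), `hqd`/`hvd` (`#Ш(Wd)_an = 1`; census: `X = L′T²/(Ω∏c ĥ) = 1` to `0e+00`, eclib-full-saturated point of height `39.6757` by `ellrank(effort=0)`, 2-descent rank `1`).
NO S2 / Σ / L₀ / L₁.  Per curve; U₀ (26024) stays OPEN class-wide; BSD is NOT proved by this.
[cite: JetchevSkinnerWan2017, §7.4.2 (p. 31)] [cite: PastenShimura2024, Prop. 6.13, Lemma 6.15, Lemma 6.18] [cite: SilvermanAEC2009, VII.5 Prop. 5.1] [cite: Cremona2006, Table 1 (Cremona label 154836v1)] -/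
theorem u0s_at_154836v1
    (hGZK : rank_eq_analyticRank_of_analyticRank_le_one) (hmod : hasEntireLFunction_rat)
    (hnf : exists_isNewformOf) (hJL : nonempty_shimuraParametrizationData)
    (hCO : PastenShimura2024_componentOrders) (hPrim : shimuraCurve_heegnerSystem_primitivesAtThree)
    {W : WeierstrassCurve ℚ} [W.IsElliptic] [W.IsGloballyMinimal] (hWeq : W = (⟨0, 0, 0, -4892688, -4165521660⟩ : WeierstrassCurve ℚ))
    (hN : W.conductorNorm ℤ = 154836) [NeZero (W.conductorNorm ℤ)] (hr : W.analyticRank = 0)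
    (Dt : ModularParametrizationData W (W.conductorNorm ℤ)) (hc : ¬ (3 : ℤ) ∣ Dt.c)
    (hLt0 : (W.quadraticTwist (((-551 : ℤ) : ℚ))).entireLFunction 1 = 0) (hLt1 : deriv (W.quadraticTwist (((-551 : ℤ) : ℚ))).entireLFunction 1 ≠ 0)
    {qd : ℚ} (hqd : haveI := isElliptic_sWd154836v1; shaAn (⟨0, 0, 0, -1485424969488, 696825754365210660⟩ : WeierstrassCurve ℚ) = (qd : ℂ))
    (hvd : padicValRat 3 qd ≤ 0) :
    MissingUpperBoundAt W 3 := by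
  subst hWeq
  haveI := isElliptic_sWd154836v1; haveI := isGloballyMinimal_sWd154836v1
  have hI : integralModelInt (⟨0, 0, 0, -4892688, -4165521660⟩ : WeierstrassCurve ℚ) = (⟨0, 0, 0, -4892688, -4165521660⟩ : WeierstrassCurve ℤ) :=
    integralModelInt_eq_of_map_eq _ (map_mk_int 0 0 0 (-4892688) (-4165521660))
  have hGS := subGss_three_154836v1 (W := (⟨0, 0, 0, -4892688, -4165521660⟩ : WeierstrassCurve ℚ)) rfl
  have hsurj := surj_three_154836v1 (W := (⟨0, 0, 0, -4892688, -4165521660⟩ : WeierstrassCurve ℚ)) rfl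
  haveI : Fact ((-551 : ℤ) < 0) := ⟨by norm_num⟩; haveI : Fact (Nat.Prime 2) := ⟨by norm_num⟩
  haveI : Fact (Nat.Prime 17) := ⟨by norm_num⟩; haveI : Fact (Nat.Prime 11) := ⟨by norm_num⟩
  have hbad₁ := WeierstrassCurve.not_hasGoodReductionAtPrime_of_dvd_minimalDiscriminantInt (⟨0, 0, 0, -4892688, -4165521660⟩ : WeierstrassCurve ℚ) 2 (by rw [IntModel.minimalDiscriminantInt_eq hI, Δ_eq_154836v1]; norm_num)
  have hm₁ : (⟨0, 0, 0, -4892688, -4165521660⟩ : WeierstrassCurve ℚ).HasMultiplicativeReductionAtPrime 17 := IntModel.hasMultiplicativeReductionAtPrime_of_intModel hI 17 (by rw [Δ_eq_154836v1]; norm_num) (by rw [c₄_eq_154836v1]; norm_num)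
  have hm₂ : (⟨0, 0, 0, -4892688, -4165521660⟩ : WeierstrassCurve ℚ).HasMultiplicativeReductionAtPrime 11 := IntModel.hasMultiplicativeReductionAtPrime_of_intModel hI 11 (by rw [Δ_eq_154836v1]; norm_num) (by rw [c₄_eq_154836v1]; norm_num)
  have hFC : ∀ (ℓ : ℕ) [Fact ℓ.Prime], ℓ ≠ 17 → ℓ ≠ 11 → ℓ ≠ 2 → (⟨0, 0, 0, -4892688, -4165521660⟩ : WeierstrassCurve ℚ).HasSplitMultiplicativeReductionAtPrime ℓ →
      ¬ 3 ∣ padicValInt ℓ (⟨0, 0, 0, -4892688, -4165521660⟩ : WeierstrassCurve ℚ).minimalDiscriminantInt := by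
    intro ℓ hℓF hne₁ hne₂ hneq hs
    have hd := dvd_minimalDiscriminantInt_of_mult _ ℓ hs.hasMultiplicativeReductionAtPrime
    rw [IntModel.minimalDiscriminantInt_eq hI, Δ_eq_154836v1] at hd
    have hmem := mem_of_prime_dvd_of_prodPow_eq _ krausList_154836v1 hℓF.out hd
    simp only [List.map_cons, List.map_nil, List.mem_cons, List.not_mem_nil, or_false] at hmem
    rcases hmem with rfl | rfl | rfl | rfl | rfl
    · exact absurd rfl hneq
    · exact absurd hs.hasMultiplicativeReductionAtPrime (X9.PrintCert.not_hasMultiplicativeReductionAtPrime_of_dvd_of_dvd hI 3 (by rw [Δ_eq_154836v1]; norm_num) (by rw [c₄_eq_154836v1]; norm_num))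
    · exact absurd rfl hne₂
    · exact absurd rfl hne₁
    · rw [IntModel.minimalDiscriminantInt_eq hI, Δ_eq_154836v1, IntModel.padicValInt_eq_of_dvd_of_not_dvd 23 (e := 2) (by norm_num) (by norm_num)]
      decide
  have hshape : ∀ (q : ℕ) [Fact q.Prime], q ≠ 2 → 3 ∣ ((⟨0, 0, 0, -4892688, -4165521660⟩ : WeierstrassCurve ℚ).baseChange ℚ_[q]).localTamagawaNumber ℤ_[q] →
      (⟨0, 0, 0, -4892688, -4165521660⟩ : WeierstrassCurve ℚ).HasSplitMultiplicativeReductionAtPrime q := by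
    intro q hqF hq h3
    by_cases hd : (q : ℤ) ∣ minimalDiscriminantInt (⟨0, 0, 0, -4892688, -4165521660⟩ : WeierstrassCurve ℚ)
    swap
    · exact absurd h3 (not_three_dvd_localTamagawaNumber_of_not_dvd _ q hd)
    rw [IntModel.minimalDiscriminantInt_eq hI, Δ_eq_154836v1] at hd
    have hmem := mem_of_prime_dvd_of_prodPow_eq _ krausList_154836v1 hqF.out hd
    simp only [List.map_cons, List.map_nil, List.mem_cons, List.not_mem_nil, or_false] at hmem
    rcases hmem with rfl | rfl | rfl | rfl | rfl
    · exact absurd rfl hq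
    · have hc3 : ((⟨0, 0, 0, -4892688, -4165521660⟩ : WeierstrassCurve ℚ).baseChange ℚ_[3]).localTamagawaNumber ℤ_[3] = 2 := -- additive `3` (I0*): Tate certificate
        (IntModelTam.localTamagawaNumber_padic_eq_of_intModel_of_tamZ hI 3 (F := ⟨3, 9, 0, 0, 0, 6, 0, 1⟩) rfl (by decide +kernel)).trans (by decide)
      rw [hc3] at h3; exact absurd h3 (by decide)
    · exact (Koly.split_and_three_dvd_of_mult_of_three_dvd_localTamagawaNumber _ 11 (IntModel.hasMultiplicativeReductionAtPrime_of_intModel hI 11 (by rw [Δ_eq_154836v1]; norm_num) (by rw [c₄_eq_154836v1]; norm_num)) h3).1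
    · exact (Koly.split_and_three_dvd_of_mult_of_three_dvd_localTamagawaNumber _ 17 (IntModel.hasMultiplicativeReductionAtPrime_of_intModel hI 17 (by rw [Δ_eq_154836v1]; norm_num) (by rw [c₄_eq_154836v1]; norm_num)) h3).1
    · exact (Koly.split_and_three_dvd_of_mult_of_three_dvd_localTamagawaNumber _ 23 (IntModel.hasMultiplicativeReductionAtPrime_of_intModel hI 23 (by rw [Δ_eq_154836v1]; norm_num) (by rw [c₄_eq_154836v1]; norm_num)) h3).1
  have hjac : ∀ ℓ : ℕ, ℓ.Prime → ℓ ∣ (⟨0, 0, 0, -4892688, -4165521660⟩ : WeierstrassCurve ℚ).conductorNorm ℤ → ℓ ≠ 17 → ℓ ≠ 11 → ℓ ≠ 2 →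
      jacobiSym (-551) ℓ = 1 := by
    intro ℓ hℓ hℓN hne₁ hne₂ hℓ2
    rw [hN] at hℓN
    have hmem : ℓ ∈ Nat.primeFactors 154836 := Nat.mem_primeFactors.mpr ⟨hℓ, hℓN, by norm_num⟩
    rw [show Nat.primeFactors 154836 = {2, 3, 11, 17, 23} by decide +kernel] at hmem
    simp only [Finset.mem_insert, Finset.mem_singleton] at hmem
    rcases hmem with rfl | rfl | rfl | rfl | rfl
    · exact absurd rfl hℓ2
    · norm_num [jacobiSym.mod_left]
    · exact absurd rfl hne₂
    · exact absurd rfl hne₁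
    · norm_num [jacobiSym.mod_left]
  have hWd : (⟨1, (0 : ℚ), (0 : ℚ), (0 : ℚ)⟩ : VariableChange ℚ) • (⟨0, 0, 0, -4892688, -4165521660⟩ : WeierstrassCurve ℚ).quadraticTwist (((-551 : ℤ) : ℚ)) =
      (⟨0, 0, 0, -1485424969488, 696825754365210660⟩ : WeierstrassCurve ℚ) := by
    push_cast; ext <;> simp [WeierstrassCurve.variableChange_a₁, WeierstrassCurve.variableChange_a₂,
      WeierstrassCurve.variableChange_a₃, WeierstrassCurve.variableChange_a₄, WeierstrassCurve.variableChange_a₆,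
      WeierstrassCurve.quadraticTwist, WeierstrassCurve.b₂, WeierstrassCurve.b₄, WeierstrassCurve.b₆] <;> norm_num
  exact leafRankZeroUpper_three_at_saving_of_sqrtField hGZK hmod hnf hJL hCO hPrim _ hGS.1 hGS.2 hr hsurj rfl Dt hc 2 hbad₁
    (s₁ := 17) (s₂ := 11) (by decide) (by decide) (by decide) hm₁ hm₂ hFC hshape
    (Or.inl (by rw [IntModel.minimalDiscriminantInt_eq hI, Δ_eq_154836v1, IntModel.padicValInt_eq_of_dvd_of_not_dvd 17 (e := 1) (by norm_num) (by norm_num)]; decide))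
    (-551) (by norm_num) (by rw [show (-551 : ℤ).natAbs = 551 by rfl, Nat.squarefree_iff_nodup_primeFactorsList (by norm_num)]; simp)
    (Or.inr ⟨by decide, by norm_num [jacobiSym.mod_left]⟩) (by norm_num) (Or.inr ⟨by decide, by norm_num [jacobiSym.mod_left]⟩) (by norm_num) hjac
    (fun _ _ _ ↦ by norm_num) hLt0 hLt1 _ _ hWd hqd hvd

/-! ## §10 `212940t1` = `[0, 0, 0, -1872, -31239]`, `N = 212940 = 2^2·3^2·5·7·13^2` (`2`: IV, `c = 3`, `3`: I₀*, `c = 1`, `5`: I3, `c = 3`, split, `7`: I1, `c = 1`, non-split, `13`: II, `c = 1`); exempted carrier `q₁ = 2` (additive IV, `c = 3`), inert set `S = {7, 5}` (multiplicative), (DEG) très ramifié at `s₁ = 7` (`3 ∤ ord_{7} Δ = 1`);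
`ρ̄₃` onto (certificate primes `ℓ₁ = 11`, `#Ẽ(𝔽_{11}) = 8`; `ℓ₂ = 31`, `#Ẽ(𝔽_{31}) = 30`); `r_an = 0`, `#E(ℚ)_tors = 1`, `∏ c_ℓ = 9`, `#Ш(E)_an = 1` (Cremona/LMFDB, displayed where used); class `212940t` of size 1.
`V = E^{(-3)}_min = [0, 0, 0, -208, 1157]` (`#Ṽ(𝔽₃) = 1`).  JSW field `K = ℚ(√-23)` (`23` prime; `7`, `5` inert, every other `ℓ ∣ N` split): the least such `D` (among those tried) with a CERTIFIED twist unit (kit j322551: root no. `−1`, `L′(Wd,1) = 6.077929`, `Wd = E^{(-23)}_min = [0, 0, 0, -990288, 380084913]`, `N(Wd) = 112645260`, `∏c = 6`, `T = 1`, point by `ellrank(effort=0)`, eclib-full saturation (index 1), `ĥ = 3.247690`,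
`X = L′T²/(Ω∏c ĥ) = 1` to `0e+00` — the numerical `#Ш(Wd)_an` given rank `1`). -/

/-- `V = [0, 0, 0, -208, 1157]` (the minimal model of `212940t1^{(-3)}`, conductor `23660`): `Δ ≠ 0` in the kernel. [cite: Cremona2006, Table 1 (Cremona label 212940t1)] -/
theorem isElliptic_sV212940t1 : (⟨0, 0, 0, -208, 1157⟩ : WeierstrassCurve ℚ).IsElliptic :=
  isElliptic_of_discOf_ne_zero 0 0 0 (-208) 1157 (by decide +kernel)

/-- `V` is globally minimal: `|Δ| = 2^4·5^3·7·13^2` kernel-checked, Kraus' criterion prime by prime. [cite: Kraus1989, Prop. 1 and Prop. 2]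
[cite: SilvermanAEC2009, VII.1 Remark 1.1] [cite: Cremona2006, Table 1 (Cremona label 212940t1)] -/
theorem isGloballyMinimal_sV212940t1 : (⟨0, 0, 0, -208, 1157⟩ : WeierstrassCurve ℚ).IsGloballyMinimal :=
  isGloballyMinimal_of_krausCriterion₃_factored 0 0 0 (-208) 1157
    [(2, 4), (5, 3), (7, 1), (13, 2)] (by decide +kernel)
    (by intro qe hqe; simp only [List.mem_cons, List.not_mem_nil, or_false] at hqe
        rcases hqe with rfl | rfl | rfl | rfl <;> norm_num)
    (by set_option synthInstance.maxSize 2000 in decide +kernel)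

/-- `Wd = [0, 0, 0, -990288, 380084913]` (the minimal model of the twist `212940t1^{(-23)}`, conductor `112645260`): `Δ ≠ 0` in the kernel. [cite: Cremona2006, Table 1 (Cremona label 212940t1)] -/
theorem isElliptic_sWd212940t1 : (⟨0, 0, 0, -990288, 380084913⟩ : WeierstrassCurve ℚ).IsElliptic :=
  isElliptic_of_discOf_ne_zero 0 0 0 (-990288) 380084913 (by decide +kernel)

/-- `Wd` is globally minimal: `|Δ| = 2^4·3^6·5^3·7·13^2·23^6` kernel-checked, Kraus' criterion prime by prime. [cite: Kraus1989, Prop. 1 and Prop. 2]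
[cite: SilvermanAEC2009, VII.1 Remark 1.1] [cite: Cremona2006, Table 1 (Cremona label 212940t1)] -/
theorem isGloballyMinimal_sWd212940t1 : (⟨0, 0, 0, -990288, 380084913⟩ : WeierstrassCurve ℚ).IsGloballyMinimal :=
  isGloballyMinimal_of_krausCriterion₃_factored 0 0 0 (-990288) 380084913
    [(2, 4), (3, 6), (5, 3), (7, 1), (13, 2), (23, 6)] (by decide +kernel)
    (by intro qe hqe; simp only [List.mem_cons, List.not_mem_nil, or_false] at hqe
        rcases hqe with rfl | rfl | rfl | rfl | rfl | rfl <;> norm_num)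
    (by set_option synthInstance.maxSize 2000 in decide +kernel)

/-- **`212940t1` is ADDITIVE at `3` and on the cell (G) ∧ ss, IN THE KERNEL**: `3 ∣ Δ`, `3 ∣ c₄`; `C • V^{(-3)} = E` (`[u, r, s, t] = [1, 0, 0, 0]`) with
`V` globally minimal, `3 ∤ Δ(V)`, `#Ṽ(𝔽₃) = 1` (`a₃(V) = 3`, supersingular), whence `TypeG`, `SubGord`, `SubGss` at `3` (g13's block, unchanged).
[cite: SilvermanAEC2009, VII.5 Prop. 5.1 (a), (c)] [cite: Delbourgo1998, §1.5 (G)] [cite: Cremona2006, Table 1 (Cremona label 212940t1)] -/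
theorem subGss_three_212940t1 {W : WeierstrassCurve ℚ} [W.IsElliptic] [W.IsGloballyMinimal] (hWeq : W = (⟨0, 0, 0, -1872, -31239⟩ : WeierstrassCurve ℚ)) :
    Addv W 3 ∧ SubGss W 3 := by
  subst hWeq
  haveI := isElliptic_sV212940t1
  haveI := isGloballyMinimal_sV212940t1
  have hIW : integralModelInt (⟨0, 0, 0, -1872, -31239⟩ : WeierstrassCurve ℚ) = (⟨0, 0, 0, -1872, -31239⟩ : WeierstrassCurve ℤ) :=
    integralModelInt_eq_of_map_eq _ (map_mk_int 0 0 0 (-1872) (-31239))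
  have hadd : Addv (⟨0, 0, 0, -1872, -31239⟩ : WeierstrassCurve ℚ) 3 := Additive.addv_of_intModel hIW 3 (by decide +kernel) (by decide +kernel)
  have hIV : integralModelInt (⟨0, 0, 0, -208, 1157⟩ : WeierstrassCurve ℚ) = (⟨0, 0, 0, -208, 1157⟩ : WeierstrassCurve ℤ) :=
    integralModelInt_eq_of_map_eq _ (map_mk_int 0 0 0 (-208) 1157)
  have hcV : Nat.card ((((⟨0, 0, 0, -208, 1157⟩ : WeierstrassCurve ℤ)).map (Int.castRingHom (ZMod 3))).toAffine.Point) = 1 := by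
    have h := natCard_point_eq_countPoints 0 0 0 (-208) 1157 3 (by norm_num) (by decide +kernel)
    have h' : countPoints [0, 0, 0, -208, 1157] 3 = 1 := countPoints_eq_of_fast (by decide +kernel)
    exact_mod_cast h.trans h'
  have hgood : GoodSS (⟨0, 0, 0, -208, 1157⟩ : WeierstrassCurve ℚ) 3 := Supersingular.goodSS_of_intModel 3 hIV (by decide +kernel) hcV (by decide)
  have hVW : (⟨1, (0 : ℚ), (0 : ℚ), (0 : ℚ)⟩ : VariableChange ℚ) • (⟨0, 0, 0, -208, 1157⟩ : WeierstrassCurve ℚ).quadraticTwist (-3) =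
      (⟨0, 0, 0, -1872, -31239⟩ : WeierstrassCurve ℚ) := by
    ext <;> simp [WeierstrassCurve.variableChange_a₁, WeierstrassCurve.variableChange_a₂,
      WeierstrassCurve.variableChange_a₃, WeierstrassCurve.variableChange_a₄, WeierstrassCurve.variableChange_a₆,
      WeierstrassCurve.quadraticTwist, WeierstrassCurve.b₂, WeierstrassCurve.b₄, WeierstrassCurve.b₆] <;> norm_num
  obtain ⟨C, hC⟩ := exists_variableChange_quadraticTwist_symm (⟨0, 0, 0, -1872, -31239⟩ : WeierstrassCurve ℚ)
    (⟨0, 0, 0, -208, 1157⟩ : WeierstrassCurve ℚ) (d := (-3 : ℚ)) (by norm_num) ⟨_, hVW⟩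
  have hC' : C • (⟨0, 0, 0, -1872, -31239⟩ : WeierstrassCurve ℚ).quadraticTwist ((-1 : ℚ) ^ ((3 : ℕ) / 2) * (3 : ℕ)) =
      (⟨0, 0, 0, -208, 1157⟩ : WeierstrassCurve ℚ) := by
    rw [O5.pstar_three]; exact hC
  have hG : TypeG (⟨0, 0, 0, -1872, -31239⟩ : WeierstrassCurve ℚ) 3 := (typeG_three_iff_good_twist _ hadd _ C hC').mpr hgood.1
  exact ⟨hadd, (O5.subGss_three_iff_subGord_and_goodSS_twist _ hadd _ C hC).mpr
    ⟨subGord_three_of_typeG_of_addv _ hG hadd, hgood⟩⟩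

/-- `Δ(E₀) = -1724814000 = -2^4·3^6·5^3·7·13^2` on the integer equation of `212940t1`. [cite: Cremona2006, Table 1 (Cremona label 212940t1)] -/
theorem Δ_eq_212940t1 : (⟨0, 0, 0, -1872, -31239⟩ : WeierstrassCurve ℤ).Δ = -1724814000 := by
  norm_num [WeierstrassCurve.Δ, WeierstrassCurve.b₂, WeierstrassCurve.b₄, WeierstrassCurve.b₆, WeierstrassCurve.b₈]

/-- `c₄(E₀) = 89856` on the integer equation of `212940t1`. [cite: Cremona2006, Table 1 (Cremona label 212940t1)] -/
theorem c₄_eq_212940t1 : (⟨0, 0, 0, -1872, -31239⟩ : WeierstrassCurve ℤ).c₄ = 89856 := by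
  norm_num [WeierstrassCurve.c₄, WeierstrassCurve.b₂, WeierstrassCurve.b₄]

/-- The Kraus list of `212940t1` consists of primes and multiplies to `|Δ(E₀)|`, IN THE KERNEL: a prime dividing `Δ_min` is one of `[2, 3, 5, 7, 13]`. [cite: Cremona2006, Table 1 (Cremona label 212940t1)] -/
theorem krausList_212940t1 : (∀ qe ∈ ([(2, 4), (3, 6), (5, 3), (7, 1), (13, 2)] : List (ℕ × ℕ)), qe.1.Prime) ∧
    (([(2, 4), (3, 6), (5, 3), (7, 1), (13, 2)] : List (ℕ × ℕ)).map fun qe => qe.1 ^ qe.2).prod = (-1724814000 : ℤ).natAbs :=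
  ⟨by decide +kernel, by decide +kernel⟩

/-- **`ρ̄_{E,3}` ONTO for `212940t1`, IN THE KERNEL** (Frobenius-order witness `hasSurjectiveModNGaloisRep_of_intModel_of_irr_of_order`): at the good prime `ℓ₁ = 11` (`#Ẽ(𝔽_{11}) = 8`,
`a = 4`) `X² − aX + 11` is irreducible mod `3`; at `ℓ₂ = 31 ≡ 1 (mod 3)` (`#Ẽ = 30`, `a = 2 ≡ 2`, `9 ∤ 30`) an element of order `3`; point counts by `countPoints_eq_of_fast`
(Sage's `is_surjective(3)` agrees). [cite: Serre1972, §2.8 Prop. 19] [cite: Zywina2015, §1] [cite: Cremona2006, Table 1 (Cremona label 212940t1)] -/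
theorem surj_three_212940t1 {W : WeierstrassCurve ℚ} [W.IsElliptic] [W.IsGloballyMinimal] (hWeq : W = (⟨0, 0, 0, -1872, -31239⟩ : WeierstrassCurve ℚ)) : Surj W 3 := by
  subst hWeq
  haveI : Fact (Nat.Prime 11) := ⟨by norm_num⟩
  haveI : Fact (Nat.Prime 31) := ⟨by norm_num⟩
  have hI : integralModelInt (⟨0, 0, 0, -1872, -31239⟩ : WeierstrassCurve ℚ) = (⟨0, 0, 0, -1872, -31239⟩ : WeierstrassCurve ℤ) :=
    integralModelInt_eq_of_map_eq _ (map_mk_int 0 0 0 (-1872) (-31239))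
  have hc₁ : Nat.card ((((⟨0, 0, 0, -1872, -31239⟩ : WeierstrassCurve ℤ)).map (Int.castRingHom (ZMod 11))).toAffine.Point) = 8 := by
    exact_mod_cast (natCard_point_eq_countPoints 0 0 0 (-1872) (-31239) 11 (by norm_num) (by decide +kernel)).trans (countPoints_eq_of_fast (n := 8) (by decide +kernel))
  have hc₂ : Nat.card ((((⟨0, 0, 0, -1872, -31239⟩ : WeierstrassCurve ℤ)).map (Int.castRingHom (ZMod 31))).toAffine.Point) = 30 := by
    exact_mod_cast (natCard_point_eq_countPoints 0 0 0 (-1872) (-31239) 31 (by norm_num) (by decide +kernel)).trans (countPoints_eq_of_fast (n := 30) (by decide +kernel))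
  exact hasSurjectiveModNGaloisRep_of_intModel_of_irr_of_order hI 3 11 31 (by norm_num) (by norm_num) (by rw [Δ_eq_212940t1]; norm_num)
    (by rw [Δ_eq_212940t1]; norm_num) hc₁ hc₂ (by decide) (by decide) (by decide) (by decide)

/-- **U₀ AT `212940t1` ON ITS SAVING ROW (inert-set Shimura-curve road, TU₀|saving)** — `MissingUpperBoundAt W 3` at `W = E` (`r_an = 0`) from rhp-p2 g11's shape
p674548 `leafRankZeroUpper_three_of_shimuraInertDatum_at_saving_of_twistUnitZero` through the door `leafRankZeroUpper_three_at_saving_of_sqrtField`.  PRINTED: `hGZK hmod hnf hJL hCO hPrim`.  KERNEL: `Addv ∧ SubGss` at `3`; `ρ̄₃` onto;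
`q₁ = 2 ∣ Δ_min`; `7`, `5` multiplicative; every prime of `Δ_min` enumerated (`krausList_212940t1`) for `hFC` and for `hshape` off `q₁` (`c = 1` off `Δ_min`, Kodaira–Néron at multiplicative
primes, Tate certificates at the additive primes `[3, 13]`); (DEG) très ramifié at `s₁ = 7`; the congruences making `7`, `5` inert and the other `ℓ ∣ N` split in
`ℚ(√-23)`; `Cd • E^{(-23)} = Wd`, `Cd = [1, 0, 0, 0]`, `Wd` Kraus-minimal.  DISPLAYED: `hN`, `hr` (`r_an = 0`), `Dt`/`hc`, `hLt0`/`hLt1` (`L(E^{(-23)},1) = 0 ≠ L′`; census: root no. `−1`,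
`L′(Wd,1) ≈ 6.07793`), `hqd`/`hvd` (`#Ш(Wd)_an = 1`; census: `X = L′T²/(Ω∏c ĥ) = 1` to `0e+00`, eclib-full-saturated point of height `3.2477` by `ellrank(effort=0)`, 2-descent rank `1`).
NO S2 / Σ / L₀ / L₁.  Per curve; U₀ (26024) stays OPEN class-wide; BSD is NOT proved by this.
[cite: JetchevSkinnerWan2017, §7.4.2 (p. 31)] [cite: PastenShimura2024, Prop. 6.13, Lemma 6.15, Lemma 6.18] [cite: SilvermanAEC2009, VII.5 Prop. 5.1] [cite: Cremona2006, Table 1 (Cremona label 212940t1)] -/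
theorem u0s_at_212940t1
    (hGZK : rank_eq_analyticRank_of_analyticRank_le_one) (hmod : hasEntireLFunction_rat)
    (hnf : exists_isNewformOf) (hJL : nonempty_shimuraParametrizationData)
    (hCO : PastenShimura2024_componentOrders) (hPrim : shimuraCurve_heegnerSystem_primitivesAtThree)
    {W : WeierstrassCurve ℚ} [W.IsElliptic] [W.IsGloballyMinimal] (hWeq : W = (⟨0, 0, 0, -1872, -31239⟩ : WeierstrassCurve ℚ))
    (hN : W.conductorNorm ℤ = 212940) [NeZero (W.conductorNorm ℤ)] (hr : W.analyticRank = 0)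
    (Dt : ModularParametrizationData W (W.conductorNorm ℤ)) (hc : ¬ (3 : ℤ) ∣ Dt.c)
    (hLt0 : (W.quadraticTwist (((-23 : ℤ) : ℚ))).entireLFunction 1 = 0) (hLt1 : deriv (W.quadraticTwist (((-23 : ℤ) : ℚ))).entireLFunction 1 ≠ 0)
    {qd : ℚ} (hqd : haveI := isElliptic_sWd212940t1; shaAn (⟨0, 0, 0, -990288, 380084913⟩ : WeierstrassCurve ℚ) = (qd : ℂ))
    (hvd : padicValRat 3 qd ≤ 0) :
    MissingUpperBoundAt W 3 := by
  subst hWeq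
  haveI := isElliptic_sWd212940t1; haveI := isGloballyMinimal_sWd212940t1
  have hI : integralModelInt (⟨0, 0, 0, -1872, -31239⟩ : WeierstrassCurve ℚ) = (⟨0, 0, 0, -1872, -31239⟩ : WeierstrassCurve ℤ) :=
    integralModelInt_eq_of_map_eq _ (map_mk_int 0 0 0 (-1872) (-31239))
  have hGS := subGss_three_212940t1 (W := (⟨0, 0, 0, -1872, -31239⟩ : WeierstrassCurve ℚ)) rfl
  have hsurj := surj_three_212940t1 (W := (⟨0, 0, 0, -1872, -31239⟩ : WeierstrassCurve ℚ)) rfl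
  haveI : Fact ((-23 : ℤ) < 0) := ⟨by norm_num⟩; haveI : Fact (Nat.Prime 2) := ⟨by norm_num⟩
  haveI : Fact (Nat.Prime 7) := ⟨by norm_num⟩; haveI : Fact (Nat.Prime 5) := ⟨by norm_num⟩
  have hbad₁ := WeierstrassCurve.not_hasGoodReductionAtPrime_of_dvd_minimalDiscriminantInt (⟨0, 0, 0, -1872, -31239⟩ : WeierstrassCurve ℚ) 2 (by rw [IntModel.minimalDiscriminantInt_eq hI, Δ_eq_212940t1]; norm_num)
  have hm₁ : (⟨0, 0, 0, -1872, -31239⟩ : WeierstrassCurve ℚ).HasMultiplicativeReductionAtPrime 7 := IntModel.hasMultiplicativeReductionAtPrime_of_intModel hI 7 (by rw [Δ_eq_212940t1]; norm_num) (by rw [c₄_eq_212940t1]; norm_num)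
  have hm₂ : (⟨0, 0, 0, -1872, -31239⟩ : WeierstrassCurve ℚ).HasMultiplicativeReductionAtPrime 5 := IntModel.hasMultiplicativeReductionAtPrime_of_intModel hI 5 (by rw [Δ_eq_212940t1]; norm_num) (by rw [c₄_eq_212940t1]; norm_num)
  have hFC : ∀ (ℓ : ℕ) [Fact ℓ.Prime], ℓ ≠ 7 → ℓ ≠ 5 → ℓ ≠ 2 → (⟨0, 0, 0, -1872, -31239⟩ : WeierstrassCurve ℚ).HasSplitMultiplicativeReductionAtPrime ℓ →
      ¬ 3 ∣ padicValInt ℓ (⟨0, 0, 0, -1872, -31239⟩ : WeierstrassCurve ℚ).minimalDiscriminantInt := by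
    intro ℓ hℓF hne₁ hne₂ hneq hs
    have hd := dvd_minimalDiscriminantInt_of_mult _ ℓ hs.hasMultiplicativeReductionAtPrime
    rw [IntModel.minimalDiscriminantInt_eq hI, Δ_eq_212940t1] at hd
    have hmem := mem_of_prime_dvd_of_prodPow_eq _ krausList_212940t1 hℓF.out hd
    simp only [List.map_cons, List.map_nil, List.mem_cons, List.not_mem_nil, or_false] at hmem
    rcases hmem with rfl | rfl | rfl | rfl | rfl
    · exact absurd rfl hneq
    · exact absurd hs.hasMultiplicativeReductionAtPrime (X9.PrintCert.not_hasMultiplicativeReductionAtPrime_of_dvd_of_dvd hI 3 (by rw [Δ_eq_212940t1]; norm_num) (by rw [c₄_eq_212940t1]; norm_num))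
    · exact absurd rfl hne₂
    · exact absurd rfl hne₁
    · exact absurd hs.hasMultiplicativeReductionAtPrime (X9.PrintCert.not_hasMultiplicativeReductionAtPrime_of_dvd_of_dvd hI 13 (by rw [Δ_eq_212940t1]; norm_num) (by rw [c₄_eq_212940t1]; norm_num))
  have hshape : ∀ (q : ℕ) [Fact q.Prime], q ≠ 2 → 3 ∣ ((⟨0, 0, 0, -1872, -31239⟩ : WeierstrassCurve ℚ).baseChange ℚ_[q]).localTamagawaNumber ℤ_[q] →
      (⟨0, 0, 0, -1872, -31239⟩ : WeierstrassCurve ℚ).HasSplitMultiplicativeReductionAtPrime q := by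
    intro q hqF hq h3
    by_cases hd : (q : ℤ) ∣ minimalDiscriminantInt (⟨0, 0, 0, -1872, -31239⟩ : WeierstrassCurve ℚ)
    swap
    · exact absurd h3 (not_three_dvd_localTamagawaNumber_of_not_dvd _ q hd)
    rw [IntModel.minimalDiscriminantInt_eq hI, Δ_eq_212940t1] at hd
    have hmem := mem_of_prime_dvd_of_prodPow_eq _ krausList_212940t1 hqF.out hd
    simp only [List.map_cons, List.map_nil, List.mem_cons, List.not_mem_nil, or_false] at hmem
    rcases hmem with rfl | rfl | rfl | rfl | rfl
    · exact absurd rfl hq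
    · have hc3 : ((⟨0, 0, 0, -1872, -31239⟩ : WeierstrassCurve ℚ).baseChange ℚ_[3]).localTamagawaNumber ℤ_[3] = 1 := -- additive `3` (I0*): Tate certificate
        (IntModelTam.localTamagawaNumber_padic_eq_of_intModel_of_tamZ hI 3 (F := ⟨3, 9, 0, 0, 0, 6, 0, 0⟩) rfl (by decide +kernel)).trans (by decide)
      rw [hc3] at h3; exact absurd h3 (by decide)
    · exact (Koly.split_and_three_dvd_of_mult_of_three_dvd_localTamagawaNumber _ 5 (IntModel.hasMultiplicativeReductionAtPrime_of_intModel hI 5 (by rw [Δ_eq_212940t1]; norm_num) (by rw [c₄_eq_212940t1]; norm_num)) h3).1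
    · exact (Koly.split_and_three_dvd_of_mult_of_three_dvd_localTamagawaNumber _ 7 (IntModel.hasMultiplicativeReductionAtPrime_of_intModel hI 7 (by rw [Δ_eq_212940t1]; norm_num) (by rw [c₄_eq_212940t1]; norm_num)) h3).1
    · have hc13 : ((⟨0, 0, 0, -1872, -31239⟩ : WeierstrassCurve ℚ).baseChange ℚ_[13]).localTamagawaNumber ℤ_[13] = 1 := -- additive `13` (II): Tate certificate
        IntModelTam.localTamagawaNumber_padic_eq_of_intModel_of_tamLocal hI 13 (E := ⟨13, 3, 4, 0, 0, 0, 0, 2, 2, 1, 1⟩) rfl (by decide +kernel) (c := 1) rfl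
      rw [hc13] at h3; exact absurd h3 (by decide)
  have hjac : ∀ ℓ : ℕ, ℓ.Prime → ℓ ∣ (⟨0, 0, 0, -1872, -31239⟩ : WeierstrassCurve ℚ).conductorNorm ℤ → ℓ ≠ 7 → ℓ ≠ 5 → ℓ ≠ 2 →
      jacobiSym (-23) ℓ = 1 := by
    intro ℓ hℓ hℓN hne₁ hne₂ hℓ2
    rw [hN] at hℓN
    have hmem : ℓ ∈ Nat.primeFactors 212940 := Nat.mem_primeFactors.mpr ⟨hℓ, hℓN, by norm_num⟩
    rw [show Nat.primeFactors 212940 = {2, 3, 5, 7, 13} by decide +kernel] at hmem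
    simp only [Finset.mem_insert, Finset.mem_singleton] at hmem
    rcases hmem with rfl | rfl | rfl | rfl | rfl
    · exact absurd rfl hℓ2
    · norm_num [jacobiSym.mod_left]
    · exact absurd rfl hne₂
    · exact absurd rfl hne₁
    · norm_num [jacobiSym.mod_left]
  have hWd : (⟨1, (0 : ℚ), (0 : ℚ), (0 : ℚ)⟩ : VariableChange ℚ) • (⟨0, 0, 0, -1872, -31239⟩ : WeierstrassCurve ℚ).quadraticTwist (((-23 : ℤ) : ℚ)) =
      (⟨0, 0, 0, -990288, 380084913⟩ : WeierstrassCurve ℚ) := by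
    push_cast; ext <;> simp [WeierstrassCurve.variableChange_a₁, WeierstrassCurve.variableChange_a₂,
      WeierstrassCurve.variableChange_a₃, WeierstrassCurve.variableChange_a₄, WeierstrassCurve.variableChange_a₆,
      WeierstrassCurve.quadraticTwist, WeierstrassCurve.b₂, WeierstrassCurve.b₄, WeierstrassCurve.b₆] <;> norm_num
  exact leafRankZeroUpper_three_at_saving_of_sqrtField hGZK hmod hnf hJL hCO hPrim _ hGS.1 hGS.2 hr hsurj rfl Dt hc 2 hbad₁
    (s₁ := 7) (s₂ := 5) (by decide) (by decide) (by decide) hm₁ hm₂ hFC hshape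
    (Or.inl (by rw [IntModel.minimalDiscriminantInt_eq hI, Δ_eq_212940t1, IntModel.padicValInt_eq_of_dvd_of_not_dvd 7 (e := 1) (by norm_num) (by norm_num)]; decide))
    (-23) (by norm_num) (by rw [show (-23 : ℤ).natAbs = 23 by rfl, Nat.squarefree_iff_nodup_primeFactorsList (by norm_num)]; simp)
    (Or.inr ⟨by decide, by norm_num [jacobiSym.mod_left]⟩) (by norm_num) (Or.inr ⟨by decide, by norm_num [jacobiSym.mod_left]⟩) (by norm_num) hjac
    (fun _ _ _ ↦ by norm_num) hLt0 hLt1 _ _ hWd hqd hvd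

end Summit.BirchSwinnertonDyer.BirchSwinnertonDyer.Theorems.RamifiedHeegnerPairTwistUnitSaving

end
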